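import Mathlib
import HarnessLib
import Summits.ValiantsHypothesis.ValiantsHypothesis.Theorems.MonotoneRestorationOrbitRestorationQPColUntwistedMain
import Summits.ValiantsHypothesis.ValiantsHypothesis.Theorems.MonotoneRestorationOrbitRestorationQPColumnGroupedEven

/-!
# Partial products over a column-stable class of column labels are narrow (supports form, parity hypothesis)

Route MonotoneRestoration, crux `OrbitRestorationQP` (stmt-ValiantsHypothesis-18293), SPAN-currency lane of the open
sub-rung A_∞ (`stub_sigmaPiSigmaValue`), `ΠΣ` part; residue R3.  Helper (`--supports`), def-free.  The PARTIAL-product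
form of `SuperAtoms.prod_mem_narrowSpan_of_colStabUntwisted_supports`, in the style of
`NormalisedFactors.prod_goodBlocks_mem_narrowSpan`:

* **`prod_goodCols_mem_narrowSpan_supports`** — let `C a · Π_i L_i ≠ 0` (degree-one factors) be invariant under every
  row/column renaming, with a column-support labelling `S` (`|S(L_i)| ≤ c₀`, `2c₀ < n`), and let `Good` be a class of
  column labels closed under the column action.  If the column groupings `G_T` (`T ∈ Good`, occurring) have trivial
  `Sym(T)`-character and the number of `Good` labels whose grouping is NOT row-invariant is even, then the partial product
  `Π_{i : S(L_i) ∈ Good} L_i` lies in `span_ℂ {hom_{F,n} : tw F ≤ 2c₀ + 1}` — no invariance of the partial product is needed.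

Use: split the column labels of a matrix-symmetric affine product into classes (e.g. by the orbit type of the blocks they
carry); classes whose groupings are column-untwisted are handled here, the others on the row side after transposition
(`…TransposeSpan.lean`); the parity hypothesis is where the global sign characters of the classes must compensate.
No registered stub is closed; the crux and VP ≠ VNP are not moved. [folklore; cite: DwivediPagoSeppelt2026, §8]
-/

noncomputable section

open scoped Pointwise

-- `Summit.ValiantsHypothesis.ValiantsHypothesis.…` is the tree's single-conjunct layout (Sub = Summit).
set_option linter.dupNamespace false

namespace Summit.ValiantsHypothesis.ValiantsHypothesis.Theorems

namespace SuperAtoms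

open MvPolynomial Finset Equiv ProductAction
open Literature.Computability.AlgebraicComplexity (homPoly)
open Literature.Combinatorics.SimpleGraph (treewidth)

variable {n : ℕ}

/-- **PARTIAL PRODUCTS OVER A COLUMN-STABLE CLASS OF COLUMN LABELS ARE NARROW (supports form, parity hypothesis).**
[folklore; cite: DwivediPagoSeppelt2026, §8; Weyl1939, Chap. II §3; Macdonald1995, §I.2] -/
theorem prod_goodCols_mem_narrowSpan_supports (c₀ : ℕ) (hc₀ : 2 * c₀ < n)
    {ι : Type} [Fintype ι] (L : ι → MvPolynomial (Fin n × Fin n) ℂ) (a : ℂ) (hL1 : ∀ i, (L i).totalDegree = 1)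
    (hf0 : C a * ∏ i, L i ≠ 0)
    (hfix : ∀ σ τ : Perm (Fin n),
      rename (fun P : Fin n × Fin n => (σ P.1, τ P.2)) (C a * ∏ i, L i) = C a * ∏ i, L i)
    (S : MvPolynomial (Fin n × Fin n) ℂ → Finset (Fin n))
    (S1 : ∀ (q : MvPolynomial (Fin n × Fin n) ℂ) (u : ℂ), u ≠ 0 → S (C u * q) = S q)
    (S2 : ∀ (q : MvPolynomial (Fin n × Fin n) ℂ) (τ : Perm (Fin n)), S (vact (K := ℂ) colHom τ q) = τ • S q)
    (S3 : ∀ (q : MvPolynomial (Fin n × Fin n) ℂ) (σ : Perm (Fin n)), S (vact (K := ℂ) rowHom σ q) = S q)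
    (hSk : ∀ i, (S (L i)).card ≤ c₀)
    (hSfix : ∀ (i : ι) (ρ : Perm (Fin n)), (∀ x ∈ S (L i), ρ x = x) → vact (K := ℂ) colHom ρ (L i) = L i)
    (Good : Finset (Fin n) → Prop) [DecidablePred Good]
    (hGood : ∀ (τ : Perm (Fin n)) (T : Finset (Fin n)), Good T → Good (τ • T))
    (Hstab : ∀ (τ : Perm (Fin n)) (T : Finset (Fin n)) (c : ℂ), Good T → (∃ i, S (L i) = T) → τ • T = T →
      rename (fun P : Fin n × Fin n => (P.1, τ P.2)) (∏ i ∈ (univ : Finset ι).filter (fun i => S (L i) = T), L i) =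
        C c * ∏ i ∈ (univ : Finset ι).filter (fun i => S (L i) = T), L i → c = 1)
    (hpar : Even (Fintype.card {T : {T : Finset (Fin n) // Good T} // ¬ ∀ σ : Perm (Fin n),
      rename (fun P : Fin n × Fin n => (σ P.1, P.2)) (∏ i ∈ (univ : Finset ι).filter (fun i => S (L i) = T.1), L i) =
        ∏ i ∈ (univ : Finset ι).filter (fun i => S (L i) = T.1), L i})) :
    (∏ i ∈ (univ : Finset ι).filter (fun i => Good (S (L i))), L i) ∈
      Submodule.span ℂ {p : MvPolynomial (Fin n × Fin n) ℂ |
        ∃ (a b : ℕ) (E : Multiset (Fin a × Fin b)),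
          treewidth (SimpleGraph.fromRel fun u v : Fin a ⊕ Fin b =>
            ∃ e ∈ E, u = Sum.inl e.1 ∧ v = Sum.inr e.2) ≤ 2 * c₀ + 1 ∧ p = homPoly E n ℂ} := by
  classical
  have hL0 : ∀ i, L i ≠ 0 := by
    intro i h
    exact hf0 (by rw [Finset.prod_eq_zero (Finset.mem_univ i) h, mul_zero])
  -- the groupings indexed by the `Good` labels
  set G : {T : Finset (Fin n) // Good T} → MvPolynomial (Fin n × Fin n) ℂ :=
    fun T => ∏ i ∈ (univ : Finset ι).filter (fun i => S (L i) = T.1), L i with hG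
  have hG0 : ∀ T, G T ≠ 0 := fun T => Finset.prod_ne_zero_iff.2 fun i _ => hL0 i
  have hdecomp : (∏ i ∈ (univ : Finset ι).filter (fun i => Good (S (L i))), L i) = ∏ T, G T := by
    rw [← Finset.prod_fiberwise_of_maps_to (s := (univ : Finset ι).filter (fun i => Good (S (L i))))
      (t := (univ : Finset (Finset (Fin n))).filter Good) (g := fun i => S (L i))
      (fun i hi => Finset.mem_filter.2 ⟨Finset.mem_univ _, (Finset.mem_filter.1 hi).2⟩) L]
    rw [Finset.prod_subtype ((univ : Finset (Finset (Fin n))).filter Good) (p := Good) (fun T => by simp)]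
    refine Fintype.prod_congr _ _ fun T => ?_
    rw [hG, Finset.filter_filter]
    congr 1
    refine Finset.filter_congr fun i _ => ⟨fun h => h.2, fun h => ⟨by rw [h]; exact T.2, h⟩⟩
  -- explicit renamings
  have hcolfix : ∀ (i : ι) (ρ : Perm (Fin n)), (∀ x ∈ S (L i), ρ x = x) →
      rename (fun P : Fin n × Fin n => (P.1, ρ P.2)) (L i) = L i := by
    intro i ρ hρ
    rw [← vact_colHom_eq_rename]
    exact hSfix i ρ hρ
  -- (loc)
  have hloc : ∀ T : {T : Finset (Fin n) // Good T}, ∃ (c : ℕ) (ψ : Fin c → Fin n)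
      (P : MvPolynomial (Fin n × (Fin c ⊕ Unit)) ℂ), c ≤ c₀ ∧
      G T = aeval (fun w : Fin n × (Fin c ⊕ Unit) =>
        Sum.elim (fun b : Fin c => (X (w.1, ψ b) : MvPolynomial (Fin n × Fin n) ℂ))
          (fun _ : Unit => ∑ j : Fin n, (X (w.1, j) : MvPolynomial (Fin n × Fin n) ℂ)) w.2) P := by
    intro T
    by_cases hT : T.1.card ≤ c₀
    · set ψ : Fin T.1.card → Fin n := fun b => T.1.orderEmbOfFin rfl b with hψ
      have hψinj : Function.Injective ψ := (T.1.orderEmbOfFin rfl).injective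
      have hψmem : ∀ x ∈ T.1, ∃ b, ψ b = x := by
        intro x hx
        have : x ∈ Set.range (T.1.orderEmbOfFin rfl) := by rw [Finset.range_orderEmbOfFin]; exact hx
        obtain ⟨b, hb⟩ := this
        exact ⟨b, hb⟩
      have hP : ∀ i ∈ (univ : Finset ι).filter (fun i => S (L i) = T.1),
          ∃ P : MvPolynomial (Fin n × (Fin T.1.card ⊕ Unit)) ℂ,
            L i = aeval (fun w : Fin n × (Fin T.1.card ⊕ Unit) =>
              Sum.elim (fun b : Fin T.1.card => (X (w.1, ψ b) : MvPolynomial (Fin n × Fin n) ℂ))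
                (fun _ : Unit => ∑ j : Fin n, (X (w.1, j) : MvPolynomial (Fin n × Fin n) ℂ)) w.2) P := by
        intro i hi
        have hiT : S (L i) = T.1 := (Finset.mem_filter.1 hi).2
        refine exists_evalRowAtoms_of_colFixed T.1.card ψ hψinj (L i) (hL1 i).le fun ρ hρ => hcolfix i ρ ?_
        intro x hx
        rw [hiT] at hx
        obtain ⟨b, rfl⟩ := hψmem x hx
        exact hρ b
      choose P hP using hP
      refine ⟨T.1.card, ψ, ∏ i ∈ ((univ : Finset ι).filter (fun i => S (L i) = T.1)).attach, P i.1 i.2, hT, ?_⟩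
      rw [map_prod]
      show (∏ i ∈ (univ : Finset ι).filter (fun i => S (L i) = T.1), L i) = _
      conv_lhs => rw [← Finset.prod_attach]
      exact Finset.prod_congr rfl fun i _ => hP i.1 i.2
    · have hempty : (univ : Finset ι).filter (fun i => S (L i) = T.1) = ∅ := by
        refine Finset.filter_eq_empty_iff.2 fun i _ hi => hT ?_
        rw [← hi]
        exact hSk i
      refine ⟨0, Fin.elim0, 1, Nat.zero_le _, ?_⟩
      rw [hG]
      simp only [hempty, Finset.prod_empty, map_one]
  -- (rows)
  have hrowG : ∀ (σ : Perm (Fin n)) (T : {T : Finset (Fin n) // Good T}), ∃ u : ℂ,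
      rename (fun P : Fin n × Fin n => (σ P.1, P.2)) (G T) = C u * G T := by
    intro σ T
    obtain ⟨c, -, hc⟩ := NormalisedFactors.exists_unit_labelBlock_rowCol L a hL1 hf0 σ 1 (hfix σ 1) S id
      Function.injective_id S1 (fun i => by
        rw [rename_prod_eq, S3, S2, one_smul]; rfl) T.1
    exact ⟨c, hc⟩
  -- (columns) transport along `T ↦ τ • T`, which preserves `Good`
  have hGoodiff : ∀ (τ : Perm (Fin n)) (T : Finset (Fin n)), Good (τ • T) ↔ Good T := by
    intro τ T
    refine ⟨fun h => ?_, hGood τ T⟩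
    have := hGood τ⁻¹ _ h
    rwa [inv_smul_smul] at this
  have hcolG : ∀ τ : Perm (Fin n), ∃ κ : Perm {T : Finset (Fin n) // Good T}, ∀ T, ∃ u : ℂ, u ≠ 0 ∧
      rename (fun P : Fin n × Fin n => (P.1, τ P.2)) (G T) = C u * G (κ T) := by
    intro τ
    refine ⟨(MulAction.toPerm τ).subtypePerm fun T => hGoodiff τ T, fun T => ?_⟩
    obtain ⟨c, hc0, hc⟩ := NormalisedFactors.exists_unit_labelBlock_rowCol L a hL1 hf0 1 τ (hfix 1 τ) S
      (fun T : Finset (Fin n) => τ • T) (fun T T' h => smul_left_cancel τ h) S1 (fun i => by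
        rw [rename_prod_eq, S3, S2]) T.1
    refine ⟨c, hc0, ?_⟩
    rw [Equiv.Perm.subtypePerm_apply]
    exact hc
  -- (column-untwisted) from the stabiliser hypothesis
  have hcolfree : ∀ (τ : Perm (Fin n)) (T : {T : Finset (Fin n) // Good T}) (u : ℂ),
      rename (fun P : Fin n × Fin n => (P.1, τ P.2)) (G T) = C u * G T → u = 1 := by
    intro τ T c h
    by_cases hocc : ∃ i, S (L i) = T.1
    · obtain ⟨u, hu0, hu⟩ := NormalisedFactors.exists_unit_labelBlock_rowCol L a hL1 hf0 1 τ (hfix 1 τ) S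
        (fun T : Finset (Fin n) => τ • T) (fun T T' h => smul_left_cancel τ h) S1 (fun i => by
          rw [rename_prod_eq, S3, S2]) T.1
      have hconv : rename (fun P : Fin n × Fin n => (((1 : Perm (Fin n)) P.1), τ P.2))
          (∏ i ∈ (univ : Finset ι).filter (fun i => S (L i) = T.1), L i) =
          rename (fun P : Fin n × Fin n => (P.1, τ P.2))
          (∏ i ∈ (univ : Finset ι).filter (fun i => S (L i) = T.1), L i) := rfl
      rw [hconv] at hu
      have h' : rename (fun P : Fin n × Fin n => (P.1, τ P.2))
          (∏ i ∈ (univ : Finset ι).filter (fun i => S (L i) = T.1), L i) =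
          C c * ∏ i ∈ (univ : Finset ι).filter (fun i => S (L i) = T.1), L i := h
      rw [h'] at hu
      have hsq : C (c ^ 2) * (∏ i ∈ (univ : Finset ι).filter (fun i => S (L i) = T.1), L i) ^ 2 =
          C (u ^ 2) * (∏ i ∈ (univ : Finset ι).filter (fun i => S (L i) = τ • T.1), L i) ^ 2 := by
        rw [map_pow, map_pow, ← mul_pow, ← mul_pow, hu]
      have hT : τ • T.1 = T.1 :=
        NormalisedFactors.label_eq_of_block_sq_eq L hL1 hL0 S S1 T.1 (τ • T.1) hocc (c ^ 2) (u ^ 2)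
          (pow_ne_zero 2 hu0) hsq
      exact Hstab τ T.1 c T.2 hocc hT h'
    · have hempty : (univ : Finset ι).filter (fun i => S (L i) = T.1) = ∅ :=
        Finset.filter_eq_empty_iff.2 fun i _ hi => hocc ⟨i, hi⟩
      have h' : rename (fun P : Fin n × Fin n => (P.1, τ P.2))
          (∏ i ∈ (univ : Finset ι).filter (fun i => S (L i) = T.1), L i) =
          C c * ∏ i ∈ (univ : Finset ι).filter (fun i => S (L i) = T.1), L i := h
      rw [hempty, Finset.prod_empty, map_one, mul_one] at h'
      exact (C_injective _ _ (by rw [C_1]; exact h'.symm))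
  have hmem := prod_mem_narrowSpan_of_colGrouped_of_even c₀ hc₀ G hG0 hloc hrowG hcolG hcolfree hpar
  rw [hdecomp]
  exact hmem

end SuperAtoms

end Summit.ValiantsHypothesis.ValiantsHypothesis.Theorems

end
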